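import Summits.NavierStokesRegularity.NavierStokesRegularity.Theorems.TypeIQuarterGateLorentzBoundOfEnvelope
import Literature.Analysis.FluidPDE.NSCriticalClosureBesovProofs
import Literature.Analysis.FluidPDE.DistributionalToWeakCounterexample
import Literature.Analysis.FluidPDE.SelfSimilarProofs
import Literature.Analysis.FluidPDE.NSViscosityRescaling
import Mathlib.MeasureTheory.Measure.Lebesgue.EqHaar
import Mathlib.Analysis.Normed.Group.Bounded
import HarnessLib

/-!
# `TypeIQuarterGate`: the slice-wise weak-`L³` benchmark is SHARP — intermediate clouds exist
# kinematically

Tightness datum for the crux `QuarterLawTypeI` (stmt-NavierStokesRegularity-23726), line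
`lorentz-upgrade`, open stub `stub_lorentzUpgrade` = item `LorentzUpgradeTypeI` (24108).

The landed benchmark `LorentzOfEnvelope.eWeakLpPow_three_le_of_norm_le` (p817829) says: a slice with
`‖v‖ ≤ B` and `∫‖v‖² ≤ E` has weak-`L³` cube `sup_λ λ³|{λ<‖v‖}| ≤ B·E`; along a Type-I blow-up
(`B = C/√(T−t)`, `E = 2E(u₀)`) this is the cube AT THE TYPE-I RATE.  Here we prove that NOTHING
slice-wise improves it, even for smooth compactly supported DIVERGENCE-FREE fields:

* `weakL3_benchmark_sharp` — there is `κ > 0` such that for all `B, E > 0` some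
  `v ∈ C_c^∞(ℝ³; ℝ³)` with `div v = 0`, `‖v‖ ≤ B`, `∫‖v‖² ≤ E` has `sup_λ λ³|{λ<‖v‖}| ≥ κ·B·E`.
  The witness is the «intermediate-amplitude cloud» of the `LorentzUpgradeTypeI` docstring:
  `v(x) = (B/S)·θ(c x)` with `θ = curl(η e₂)` the tree's `C_c^∞` divergence-free field
  (`DistributionalToWeakCounterexample.θ`), amplitude `≍ B` on a region of volume `≍ E/B²`
  (`c³ = (B/S)² ∫‖θ‖² / E`).

CONSEQUENCE FOR THE LINE: the open stub `stub_lorentzUpgrade` (time-Type-I ⟹ `sup_t ‖u(t)‖_{L^{3,∞}} < ∞`)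
has no slice-wise proof from the rate `‖u(t)‖_∞ ≤ C/√(T−t)`, incompressibility and the energy bound
alone: at each fixed time these three constraints are compatible with a cube `≍ C·E/√(T−t) → ∞`.
Any proof must couple different times (the dynamics), as the docstring of `LorentzUpgradeTypeI`
anticipates («a proof must use NSE-only structure»).

HONEST FRAMING: a kinematic statement about single vector fields; nothing about Navier–Stokes
regularity or blow-up is claimed; `LorentzUpgradeTypeI` / `QuarterLawTypeI` remain OPEN.
[folklore]
-/

-- the problem directory repeats the summit name (`NavierStokesRegularity/NavierStokesRegularity`)
set_option linter.dupNamespace false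

noncomputable section

open Set Filter MeasureTheory Topology Metric Function
open scoped ENNReal NNReal ContDiff

namespace Summit.NavierStokesRegularity.NavierStokesRegularity.Theorems

namespace LorentzOfEnvelope

open Literature.Analysis.FluidPDE Literature.Analysis.FunctionSpaces
open Literature.Analysis.FluidPDE.DistributionalToWeakCounterexample (θ θ_contDiff θ_hasCompactSupport
  θ_isDivFree exists_θ_ne_zero)

/-! ### Dilation bookkeeping on `ℝ³` -/

/-- The superlevel sets of a dilate: `|{s < ‖f(c·)‖}| = c⁻³ |{s < ‖f‖}|` (`c > 0`). [folklore] -/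
theorem volume_superlevel_comp_smul (f : EuclideanSpace ℝ (Fin 3) → EuclideanSpace ℝ (Fin 3))
    {c : ℝ} (hc : 0 < c) (s : ℝ) :
    volume {x : EuclideanSpace ℝ (Fin 3) | s < ‖f (c • x)‖} =
      ENNReal.ofReal ((c ^ 3)⁻¹) * volume {x | s < ‖f x‖} := by
  have hset : {x : EuclideanSpace ℝ (Fin 3) | s < ‖f (c • x)‖} = (c • ·) ⁻¹' {x | s < ‖f x‖} := rfl
  rw [hset, Measure.addHaar_preimage_smul volume hc.ne', finrank_euclideanSpace_fin, ← inv_pow,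
    abs_of_nonneg (by positivity), inv_pow]

/-- The energy of an amplitude–length dilate: `∫‖a θ(c·)‖² = a² c⁻³ ∫‖θ‖²` (`a ≥ 0`, `c > 0`).
[folklore] -/
theorem lintegral_sq_dilate (f : EuclideanSpace ℝ (Fin 3) → EuclideanSpace ℝ (Fin 3))
    {a c : ℝ} (ha : 0 ≤ a) (hc : 0 < c) :
    ∫⁻ x, ‖a • f (c • x)‖ₑ ^ 2 =
      ENNReal.ofReal (a ^ 2) * (ENNReal.ofReal ((c ^ 3)⁻¹) * ∫⁻ x, ‖f x‖ₑ ^ 2) := by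
  have h1 : ∀ x, ‖a • f (c • x)‖ₑ ^ 2 = ENNReal.ofReal (a ^ 2) * ‖f (c • x)‖ₑ ^ 2 := by
    intro x
    rw [enorm_smul, mul_pow, Real.enorm_eq_ofReal ha, ENNReal.ofReal_pow ha]
  simp_rw [h1]
  rw [lintegral_const_mul' _ _ ENNReal.ofReal_ne_top,
    Literature.Analysis.FluidPDE.lintegral_comp_smul_three (fun x => ‖f x‖ₑ ^ 2) hc]

/-! ### The cloud witness -/

/-- **The slice-wise weak-`L³` benchmark `B·E` is sharp on divergence-free `C_c^∞` fields.** There is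
`κ > 0` such that for all `B, E > 0` some smooth compactly supported divergence-free
`v : ℝ³ → ℝ³` with `‖v‖ ≤ B` and `∫‖v‖² ≤ E` has `sup_λ λ³ |{λ < ‖v‖}| ≥ κ·B·E` — so the bound of
`eWeakLpPow_three_le_of_norm_le` is attained up to a constant, and the weak-`L³` cube of a slice is
not controlled by sup-norm, energy and incompressibility beyond `B·E`. [folklore] -/
theorem weakL3_benchmark_sharp :
    ∃ κ : ℝ, 0 < κ ∧ ∀ B E : ℝ, 0 < B → 0 < E →
      ∃ v : EuclideanSpace ℝ (Fin 3) → EuclideanSpace ℝ (Fin 3),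
        ContDiff ℝ ∞ v ∧ HasCompactSupport v ∧ VectorCalculus.IsDivFree v ∧
        (∀ x, ‖v x‖ ≤ B) ∧ ∫⁻ x, ‖v x‖ₑ ^ 2 ≤ ENNReal.ofReal E ∧
        ENNReal.ofReal (κ * (B * E)) ≤ eWeakLpPow v 3 volume := by
  -- the profile `θ`: smooth, compactly supported, divergence free, not identically zero
  obtain ⟨x₀, hx₀⟩ := exists_θ_ne_zero
  set w₀ : ℝ := ‖θ x₀‖ with hw₀_def
  have hw₀ : 0 < w₀ := norm_pos_iff.2 hx₀
  obtain ⟨S, hS⟩ := θ_contDiff.continuous.bounded_above_of_compact_support θ_hasCompactSupport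
  have hSw : w₀ ≤ S := hS x₀
  have hS0 : 0 < S := hw₀.trans_le hSw
  -- the fat superlevel set `U = {w₀/2 < ‖θ‖}`: open, nonempty, of finite positive measure
  set U : Set (EuclideanSpace ℝ (Fin 3)) := {x | w₀ / 2 < ‖θ x‖} with hU_def
  have hUopen : IsOpen U := isOpen_lt continuous_const θ_contDiff.continuous.norm
  have hx₀U : x₀ ∈ U := by
    show w₀ / 2 < ‖θ x₀‖
    rw [← hw₀_def]; linarith
  have hUpos : 0 < volume U := hUopen.measure_pos volume ⟨x₀, hx₀U⟩
  have hUsub : U ⊆ tsupport θ := by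
    intro x hx
    apply subset_tsupport
    rw [mem_support]
    intro h0
    have : w₀ / 2 < ‖θ x‖ := hx
    rw [h0, norm_zero] at this
    linarith
  have hUtop : volume U < ⊤ :=
    (measure_mono hUsub).trans_lt θ_hasCompactSupport.isCompact.measure_lt_top
  set m₀ : ℝ := (volume U).toReal with hm₀_def
  have hm₀ : 0 < m₀ := ENNReal.toReal_pos hUpos.ne' hUtop.ne
  have hm₀eq : ENNReal.ofReal m₀ = volume U := ENNReal.ofReal_toReal hUtop.ne
  -- the energy of the profile: finite (compact support) and positive (Chebyshev on `U`)
  have hθmem : MemLp θ 2 (volume : Measure (EuclideanSpace ℝ (Fin 3))) :=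
    θ_contDiff.continuous.memLp_of_hasCompactSupport θ_hasCompactSupport
  set e₀ : ℝ := 2 * VectorCalculus.kineticEnergy θ with he₀_def
  have he₀eq : ∫⁻ x, ‖θ x‖ₑ ^ 2 = ENNReal.ofReal e₀ := eEnergy_eq_ofReal θ hθmem
  have he₀nn : 0 ≤ e₀ := by
    rw [he₀_def]; exact mul_nonneg zero_le_two (kineticEnergy_nonneg θ)
  have hcheb : ENNReal.ofReal ((w₀ / 2) ^ 2) * volume U ≤ ENNReal.ofReal e₀ := by
    rw [← he₀eq]
    exact sq_mul_meas_superlevel_le_lintegral hθmem.1 (half_pos hw₀)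
  have he₀ : 0 < e₀ := by
    have hlhs : 0 < ENNReal.ofReal ((w₀ / 2) ^ 2) * volume U :=
      ENNReal.mul_pos (ENNReal.ofReal_pos.2 (by positivity)).ne' hUpos.ne'
    have := hlhs.trans_le hcheb
    exact ENNReal.ofReal_pos.1 this
  have hcheb' : (w₀ / 2) ^ 2 * m₀ ≤ e₀ := by
    rw [← hm₀eq, ← ENNReal.ofReal_mul (by positivity)] at hcheb
    exact (ENNReal.ofReal_le_ofReal_iff he₀nn).1 hcheb
  -- the constant
  refine ⟨w₀ ^ 3 * m₀ / (8 * S * e₀), by positivity, fun B E hB hE => ?_⟩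
  -- amplitude `a = B/S`, inverse length `c` with `c³ = a² e₀ / E`
  set a : ℝ := B / S with ha_def
  have ha : 0 < a := div_pos hB hS0
  set q : ℝ := a ^ 2 * e₀ / E with hq_def
  have hq : 0 < q := by positivity
  set c : ℝ := q ^ ((3 : ℕ) : ℝ)⁻¹ with hc_def
  have hc : 0 < c := Real.rpow_pos_of_pos hq _
  have hc3 : c ^ 3 = q := by
    rw [hc_def]
    exact Real.rpow_inv_natCast_pow hq.le three_ne_zero
  -- the witness
  refine ⟨fun x => a • θ (c • x), ?_, ?_, ?_, ?_, ?_, ?_⟩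
  · -- smooth
    exact (θ_contDiff.comp (contDiff_const_smul c)).const_smul a
  · -- compactly supported
    refine (θ_hasCompactSupport.comp_smul hc.ne').mono ?_
    intro x hx
    exact right_ne_zero_of_smul hx
  · -- divergence free
    have hd : Differentiable ℝ fun x : EuclideanSpace ℝ (Fin 3) => θ (c • x) :=
      (θ_contDiff.comp (contDiff_const_smul c)).differentiable (by simp)
    exact (θ_isDivFree.comp_smul c).const_smul hd a
  · -- sup bound `‖v‖ ≤ (B/S)·S = B`
    intro x
    rw [norm_smul, Real.norm_of_nonneg ha.le]
    calc a * ‖θ (c • x)‖ ≤ a * S := mul_le_mul_of_nonneg_left (hS _) ha.le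
      _ = B := by rw [ha_def]; field_simp
  · -- energy `a² c⁻³ e₀ = E`
    rw [lintegral_sq_dilate θ ha.le hc, he₀eq, ← ENNReal.ofReal_mul (by positivity),
      ← ENNReal.ofReal_mul (by positivity), hc3, hq_def]
    refine ENNReal.ofReal_le_ofReal (le_of_eq ?_)
    field_simp
  · -- the cube at the level `λ = a w₀/2`: `λ³ · c⁻³ |U| = κ B E`
    have hlam : 0 < a * w₀ / 2 := by positivity
    have hlev : {x : EuclideanSpace ℝ (Fin 3) | a * w₀ / 2 < ‖a • θ (c • x)‖} =
        {x | w₀ / 2 < ‖θ (c • x)‖} := by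
      ext x
      simp only [mem_setOf_eq, norm_smul, Real.norm_of_nonneg ha.le]
      constructor
      · intro h; nlinarith [ha]
      · intro h; nlinarith [ha]
    have hkey := ofReal_rpow_mul_meas_lt_le_eWeakLpPow (fun x => a • θ (c • x)) 3
      (volume : Measure (EuclideanSpace ℝ (Fin 3))) hlam
    have e3 : ENNReal.ofReal ((a * w₀ / 2) ^ (3 : ℝ≥0∞).toReal) =
        ENNReal.ofReal ((a * w₀ / 2) ^ 3) := by norm_num
    rw [e3, hlev, volume_superlevel_comp_smul θ hc (w₀ / 2), hc3] at hkey
    refine le_trans (le_of_eq ?_) hkey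
    change ENNReal.ofReal (w₀ ^ 3 * m₀ / (8 * S * e₀) * (B * E)) =
      ENNReal.ofReal ((a * w₀ / 2) ^ 3) * (ENNReal.ofReal q⁻¹ * volume U)
    rw [← hm₀eq, ← ENNReal.ofReal_mul (by positivity), ← ENNReal.ofReal_mul (by positivity)]
    congr 1
    rw [hq_def, ha_def]
    field_simp
    ring

/-! ### Along the Type-I scale: the kinematic enemy of `LorentzUpgradeTypeI` by name -/

/-- **The intermediate-amplitude cloud at the Type-I scale.** For every rate constant `C > 0`, energy
`E > 0` and time `t < T` there is a smooth compactly supported divergence-free slice `v` obeying the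
Type-I sup bound `‖v‖ ≤ C/√(T−t)` and the energy bound `∫‖v‖² ≤ E` whose weak-`L³` cube is
`≥ κ·C·E/√(T−t)` — i.e. the benchmark `eventually_eWeakLpPow_three_le_rate` (cube `≤ C·2E(u₀)/√(T−t)`)
is attained slice-wise up to a universal constant, and blows up as `t ↑ T`.  So the uniform bound
asked by `LorentzUpgradeTypeI` cannot come from rate + energy + incompressibility at single times.
[folklore] -/
theorem typeI_cloud_family :
    ∃ κ : ℝ, 0 < κ ∧ ∀ C E T t : ℝ, 0 < C → 0 < E → t < T →
      ∃ v : EuclideanSpace ℝ (Fin 3) → EuclideanSpace ℝ (Fin 3),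
        ContDiff ℝ ∞ v ∧ HasCompactSupport v ∧ VectorCalculus.IsDivFree v ∧
        (∀ x, ‖v x‖ ≤ C / Real.sqrt (T - t)) ∧ ∫⁻ x, ‖v x‖ₑ ^ 2 ≤ ENNReal.ofReal E ∧
        ENNReal.ofReal (κ * (C / Real.sqrt (T - t) * E)) ≤ eWeakLpPow v 3 volume := by
  obtain ⟨κ, hκ, h⟩ := weakL3_benchmark_sharp
  refine ⟨κ, hκ, fun C E T t hC hE ht => ?_⟩
  have hB : 0 < C / Real.sqrt (T - t) := div_pos hC (Real.sqrt_pos.2 (sub_pos.2 ht))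
  exact h (C / Real.sqrt (T - t)) E hB hE

/-- **Unbounded along the scale**: for every `C, E > 0`, `T` and every target `M`, at times `t < T`
close enough to `T` the cloud of `typeI_cloud_family` has cube `> M` while respecting the rate
`C/√(T−t)` and the energy `E`. [folklore] -/
theorem typeI_cloud_cube_unbounded (C E T M : ℝ) (hC : 0 < C) (hE : 0 < E) :
    ∃ t < T, ∃ v : EuclideanSpace ℝ (Fin 3) → EuclideanSpace ℝ (Fin 3),
      ContDiff ℝ ∞ v ∧ HasCompactSupport v ∧ VectorCalculus.IsDivFree v ∧
      (∀ x, ‖v x‖ ≤ C / Real.sqrt (T - t)) ∧ ∫⁻ x, ‖v x‖ₑ ^ 2 ≤ ENNReal.ofReal E ∧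
      ENNReal.ofReal M < eWeakLpPow v 3 volume := by
  obtain ⟨κ, hκ, h⟩ := typeI_cloud_family
  -- choose `t` with `√(T − t) = s` small: `κ C E / s > max M 0`, e.g. `s = κ C E/(|M| + 1)` capped by `1`
  set s : ℝ := min 1 (κ * C * E / (|M| + 1)) with hs_def
  have hM1 : 0 < |M| + 1 := by positivity
  have hs0 : 0 < s := lt_min one_pos (by positivity)
  have hs1 : s ≤ κ * C * E / (|M| + 1) := min_le_right _ _
  refine ⟨T - s ^ 2, by nlinarith, ?_⟩
  obtain ⟨v, hv1, hv2, hv3, hv4, hv5, hv6⟩ := h C E T (T - s ^ 2) hC hE (by nlinarith)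
  refine ⟨v, hv1, hv2, hv3, hv4, hv5, lt_of_lt_of_le ?_ hv6⟩
  have hsq : Real.sqrt (T - (T - s ^ 2)) = s := by
    rw [sub_sub_cancel, Real.sqrt_sq hs0.le]
  rw [hsq]
  refine (ENNReal.ofReal_lt_ofReal_iff (by positivity)).2 ?_
  -- `M < κ (C/s) E` since `s (|M|+1) ≤ κ C E` and `M < |M| + 1`
  have hkey : (|M| + 1) * s ≤ κ * C * E := by
    rw [mul_comm]; exact (le_div_iff₀ hM1).1 hs1
  have hM : M < |M| + 1 := (le_abs_self M).trans_lt (lt_add_one _)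
  rw [show κ * (C / s * E) = κ * C * E / s by field_simp]
  rw [lt_div_iff₀ hs0]
  nlinarith

end LorentzOfEnvelope

end Summit.NavierStokesRegularity.NavierStokesRegularity.Theorems
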